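import Mathlib
import Literature.MathematicalPhysics.QuantumFieldTheory.OSSectorContinuation
import Literature.MathematicalPhysics.QuantumFieldTheory.OSReconstructionNoE1Proofs
import HarnessLib
import Summits.QuantumFields.YangMills.Theorems.MirrorModularBoostsPlanarSpectralConeConeChainFrames
import Summits.QuantumFields.YangMills.Theorems.MirrorModularBoostsPlanarSpectralConeComplexTimeSlot
import Summits.QuantumFields.YangMills.Theorems.MirrorModularBoostsPlanarSpectralConeDiscSections

/-!
# Disc sections for cone-chain diagonal pairs (stub `stub_discSections`, crux `PlanarSpectralCone`)

Line `positivity-disc-to-operator-cone` of crux `MirrorModularBoosts.PlanarSpectralCone`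
(stmt-QuantumFields-9664), FRONT END.

Informal statement. Let `S` be a one-species Schwinger family on `ℝ⁴`, translation invariant on
`⁰𝒮` and reflection positive in the eight frames of the `(x₀,x₁)`-plane (axis and diagonal mirrors),
`h` its Osterwalder–Schrader reconstruction in the `e₀` frame (field vectors `Ψ_G = h.fieldVec`,
contraction semigroup `e^{-tH} = h.transfer t`, unitary spatial translations `U(a⃗) = h.translate a`),
and let `G` be a *strict cone chain*: an `m`-point test function supported in
`{x | ∀ i, |xᵢ¹| < xᵢ⁰ ∧ ∀ i<j, |xⱼ¹ − xᵢ¹| < xⱼ⁰ − xᵢ⁰}`. Then there are `c ≥ 0` (in fact `c = 0`)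
and ONE constant `M` such that for every `t > c` the diagonal matrix element
`b ↦ ⟪Ψ_G, e^{-tH} U(b e₁) Ψ_G⟫` is the restriction to `(-(t-c), t-c)` of a function holomorphic on
the disc of radius `t - c` and bounded there by `M`.

Proof. In light-cone coordinates `a(u,u') = ((u+u')/√2) e₀ + ((u−u')/√2) e₁` the function
`φ_G(u,u') = 𝔖_{2m}(ΘG* ⊗ G_{a(u,u')})` is two-slot sector data of opening `π/2`
(`LogSlot.IsSectorData`): by `stub_coneChainFrames` (the `±45°` frames `R±`, pulled-back
reconstructions `h±` of `S ∘ linActMulti R±`, and the identities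
`ΘG* ⊗ G_{a(u,u')} = linActMulti R₊ (ΘA₊* ⊗ (B₊)_{u e₀ − u' e₁}) = linActMulti R₋ (ΘA₋* ⊗ (B₋)_{u' e₀ + u e₁})`)
each slot is a complex-time matrix element `⟪Ψ_{A±}, e^{-τH±} U±(∓u' e₁) Ψ_{B±}⟫` of a
reconstructed semigroup, holomorphic and bounded on the right half-plane by `stub_complexTimeSlot`;
the base values are bounded by `‖Ψ_G‖²` (Cauchy–Schwarz, `‖e^{-tH}‖ ≤ 1`, `U` unitary) in the `e₀`
frame. The tree's sector engine `IsSectorData.exists_extension` continues `φ_G` to the sector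
region `{Re u, Re u' > 0, |arg u| + |arg u'| < π/2}` and the maximum principle on the flat tubes
`IsSectorData.norm_extension_le` bounds the continuation by `M` there; finally Thales
(`stub_discSections_of_sectorExtension`): the slice `u + u' = √2 t` of the sector region is the disc
`|β| < t`, `β = (u − u')/√2`, and at real `b` the value is `⟪Ψ_G, e^{-tH} U(b e₁) Ψ_G⟫`.

References: K. Osterwalder, R. Schrader, Comm. Math. Phys. 42 (1975), Ch. V (5.4)–(5.8) and
Ch. VI.2 (6.15) (sector continuation and the maximum principle); K. Osterwalder, R. Schrader,
Comm. Math. Phys. 31 (1973), §4.1 (the operators `e^{-tH}`, `U(a⃗)`).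
-/

noncomputable section

namespace Summit.QuantumFields.YangMills.Cruxes.PlanarSpectralCone.PositivityDiscToOperatorCone

open MeasureTheory
open scoped InnerProductSpace SchwartzMap
open Literature.MathematicalPhysics.QuantumLattice Literature.MathematicalPhysics.AQFT
  Literature.MathematicalPhysics.QuantumFieldTheory
open Summit.QuantumFields.YangMills.Cruxes.PlanarSpectralCone.TwoMirrorLightconeSlots

/-- Euclidean `ℝ⁴`, time = coordinate `0`, the boost plane = coordinates `0, 1` (the skeleton's
notation, so that the stub below is its registered signature verbatim). -/
local notation "E4" => EuclideanSpace ℝ (Fin 4)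

/-! ## Two-slot sector data of a cone chain

The helper lives in the sub-namespace `FrontEnd` (no collisions with the skeleton's glue). -/

namespace FrontEnd

-- ported from Cruxes/PlanarSpectralCone/Lines/two-mirror-lightcone-slots.lean (`coneSectorData`)
/-- **FRONT END assembled — two-slot sector data of a cone chain.** From `stub_coneChainFrames`
(geometry) and `stub_complexTimeSlot` (analysis, applied in the two pulled-back reconstructions)
the function `φ_G(u,u') = 𝔖_{2m}(ΘG* ⊗ G_{a(u,u')})` with its two diagonal-semigroup slots is
`LogSlot.IsSectorData (π/2) φ_G E M 0 (fun _ => M)`; the base bound `‖φ_G‖ ≤ ‖Ψ_G‖²` is read in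
the `e₀` frame. -/
theorem coneSectorData
    (S : SchwingerFamily (EuclideanSpace ℝ (Fin 4)))
    (hT : ∀ (n : ℕ) (a : EuclideanSpace ℝ (Fin 4))
      (F : SchwartzMap (Fin n → EuclideanSpace ℝ (Fin 4)) ℂ), IsOffDiagonal F →
      S n (translateMulti a F) = S n F)
    (hRP : ∀ (R : EuclideanSpace ℝ (Fin 4) ≃ₗᵢ[ℝ] EuclideanSpace ℝ (Fin 4)) (a b : ℝ),
      a ^ 2 + b ^ 2 = 1 → (a = 0 ∨ b = 0 ∨ a ^ 2 = b ^ 2) →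
      R (EuclideanSpace.single 0 1) = a • EuclideanSpace.single 0 1 + b • EuclideanSpace.single 1 1 →
      (SchwingerFamily.toLabelled (fun n => (S n).comp (linActMulti R))).IsReflectionPositive)
    (h : OSReconstructionNoE1 S.toLabelled)
    {m : ℕ} (G : SchwartzMap (Fin m → EuclideanSpace ℝ (Fin 4)) ℂ) (hG : IsTimeOrdered G)
    (hGcone : tsupport (G : (Fin m → EuclideanSpace ℝ (Fin 4)) → ℂ) ⊆
      {x | (∀ i, |x i 1| < x i 0) ∧ ∀ i j, i < j → |x j 1 - x i 1| < x j 0 - x i 0}) :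
    ∃ (M : ℝ) (E : Fin 2 → (Fin 1 → ℝ) → ℂ → ℂ),
      LogSlot.IsSectorData (Real.pi / 2)
        (fun u : Fin 2 → ℝ => S (m + m) ((osAdjoint G).appendTensor
          (translateMulti (((u 0 + u 1) / Real.sqrt 2) • EuclideanSpace.single 0 1 +
            ((u 0 - u 1) / Real.sqrt 2) • EuclideanSpace.single 1 1) G)))
        E M 0 (fun _ => M) := by
  obtain ⟨Rp, Rm, Ap, Bp, Am, Bm, hAp, hBp, hAm, hBm, hp, hm, hidp, hidm⟩ :=
    stub_coneChainFrames S hT hRP G hGcone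
  -- the two pulled-back reconstructions and their complex-time slots
  obtain ⟨Cp, Ep, hEpd, hEpc, hEpb, hEpr⟩ :=
    stub_complexTimeSlot hp (hp.fieldVec m (fun _ => ()) Ap hAp) (hp.fieldVec m (fun _ => ()) Bp hBp)
  obtain ⟨Cm, Em, hEmd, hEmc, hEmb, hEmr⟩ :=
    stub_complexTimeSlot hm (hm.fieldVec m (fun _ => ()) Am hAm) (hm.fieldVec m (fun _ => ()) Bm hBm)
  set ψG := h.fieldVec m (fun _ => ()) G hG with hψG
  set M : ℝ := max (‖ψG‖ ^ 2) (max Cp Cm) with hM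
  set Sfun : (Fin 2 → ℝ) → ℂ := fun u => S (m + m) ((osAdjoint G).appendTensor
    (translateMulti (((u 0 + u 1) / Real.sqrt 2) • EuclideanSpace.single 0 1 +
      ((u 0 - u 1) / Real.sqrt 2) • EuclideanSpace.single 1 1) G)) with hSfun
  set E : Fin 2 → (Fin 1 → ℝ) → ℂ → ℂ :=
    ![fun u' τ => Ep ((-(u' 0)) • EuclideanSpace.single 1 1) τ,
      fun u' τ => Em ((u' 0) • EuclideanSpace.single 1 1) τ] with hE
  have hM0 : 0 ≤ M := le_trans (by positivity) (le_max_left _ _)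
  -- base values in the e₀ frame
  have hbase : ∀ u : Fin 2 → ℝ, (∀ j, 0 < u j) → ‖Sfun u‖ ≤ ‖ψG‖ ^ 2 := by
    intro u hu
    have ht : 0 ≤ (u 0 + u 1) / Real.sqrt 2 := by
      have := hu 0; have := hu 1; positivity
    have e := DiscSections.pairing_eq_inner_transfer_translate S h G G hG hG ht
      ((u 0 - u 1) / Real.sqrt 2)
    simp only [hSfun]
    rw [e]
    calc ‖⟪ψG, h.transfer ((u 0 + u 1) / Real.sqrt 2)
            (h.translate (((u 0 - u 1) / Real.sqrt 2) • EuclideanSpace.single 1 1) ψG)⟫_ℂ‖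
        ≤ ‖ψG‖ * ‖h.transfer ((u 0 + u 1) / Real.sqrt 2)
            (h.translate (((u 0 - u 1) / Real.sqrt 2) • EuclideanSpace.single 1 1) ψG)‖ :=
          norm_inner_le_norm _ _
      _ ≤ ‖ψG‖ * ‖ψG‖ := by
          gcongr
          refine (h.norm_transfer_le _ _).trans ?_
          rw [LinearIsometryEquiv.norm_map]
      _ = ‖ψG‖ ^ 2 := by ring
  -- real values of the two slots
  have hreal_p : ∀ (x y : ℝ), 0 < x →
      Ep ((-y) • EuclideanSpace.single 1 1) (x : ℂ) = Sfun ![x, y] := by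
    intro x y hx
    rw [hEpr _ (by simp) x hx]
    simp only [hSfun, Matrix.cons_val_zero, Matrix.cons_val_one]
    rw [hidp x y]
    exact (DiscSections.pairing_eq_inner_transfer_translate (fun k => (S k).comp (linActMulti Rp)) hp
      Ap Bp hAp hBp hx.le (-y)).symm
  have hreal_m : ∀ (x y : ℝ), 0 < x →
      Em (y • EuclideanSpace.single 1 1) (x : ℂ) = Sfun ![y, x] := by
    intro x y hx
    rw [hEmr _ (by simp) x hx]
    simp only [hSfun, Matrix.cons_val_zero, Matrix.cons_val_one]
    rw [hidm y x]
    exact (DiscSections.pairing_eq_inner_transfer_translate (fun k => (S k).comp (linActMulti Rm)) hm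
      Am Bm hAm hBm hx.le y).symm
  refine ⟨M, E, ?_, hM0, ?_, ?_, ?_, fun _ => hM0, ?_, ?_⟩
  · -- continuity of φ_G on the open quadrant (translations are continuous on 𝒮)
    have hc := OSReconstructionNoE1.continuous_apply_appendTensor_translateMulti S.toLabelled
      ⟨m, fun _ => (), G, hG⟩ ⟨m, fun _ => (), G, hG⟩
    have hv : Continuous fun u : Fin 2 → ℝ =>
        (((u 0 + u 1) / Real.sqrt 2) • EuclideanSpace.single 0 1 +
          ((u 0 - u 1) / Real.sqrt 2) • EuclideanSpace.single 1 1 : EuclideanSpace ℝ (Fin 4)) := by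
      fun_prop
    exact (hc.comp hv).continuousOn
  · intro u hu
    rw [pow_zero, mul_one]
    exact (hbase u hu).trans (le_max_left _ _)
  · intro i τ hτ
    fin_cases i
    · simp only [hE, Fin.zero_eta, Fin.isValue, Matrix.cons_val_zero]
      exact ((hEpc τ hτ.1).comp (by fun_prop)).continuousOn
    · simp only [hE, Fin.mk_one, Fin.isValue, Matrix.cons_val_one, Matrix.cons_val_fin_one]
      exact ((hEmc τ hτ.1).comp (by fun_prop)).continuousOn
  · intro i u' hu'
    fin_cases i
    · simpa [hE] using (hEpd _).mono fun τ hτ => hτ.1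
    · simpa [hE] using (hEmd _).mono fun τ hτ => hτ.1
  · intro i c _ u' τ _ hτ _
    rw [pow_zero, pow_zero, mul_one, mul_one]
    fin_cases i
    · have := hEpb ((-(u' 0)) • EuclideanSpace.single 1 1) τ hτ
      simp only [hE, Fin.zero_eta, Fin.isValue, Matrix.cons_val_zero]
      exact this.trans ((le_max_left _ _).trans (le_max_right _ _))
    · have := hEmb ((u' 0) • EuclideanSpace.single 1 1) τ hτ
      simp only [hE, Fin.mk_one, Fin.isValue, Matrix.cons_val_one, Matrix.cons_val_fin_one]
      exact this.trans ((le_max_right _ _).trans (le_max_right _ _))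
  · intro i u' _ x hx
    fin_cases i
    · simp only [hE, Fin.zero_eta, Fin.isValue, Matrix.cons_val_zero]
      rw [hreal_p x (u' 0) hx]
      congr 1
      funext j
      fin_cases j
      · simp
      · simp
    · simp only [hE, Fin.mk_one, Fin.isValue, Matrix.cons_val_one, Matrix.cons_val_fin_one]
      rw [hreal_m x (u' 0) hx]
      have h0 : (1 : Fin 2).succAbove (0 : Fin 1) = 0 := by decide
      have h0' : Fin.insertNth (α := fun _ : Fin 2 => ℝ) (1 : Fin 2) x u' 0 = u' 0 := by
        conv_lhs => rw [← h0]
        rw [Fin.insertNth_apply_succAbove]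
      congr 1
      funext j
      fin_cases j
      · simp [h0']
      · simp

/-- **A bounded holomorphic continuation of `φ_G` to the two-slot sector region.** The sector
engine (`IsSectorData.exists_extension`) and the maximum principle on the flat tubes
(`IsSectorData.norm_extension_le`, through every opening `c < π/2`) applied to `coneSectorData`. -/
theorem exists_sectorExtension
    (S : SchwingerFamily (EuclideanSpace ℝ (Fin 4)))
    (hT : ∀ (n : ℕ) (a : EuclideanSpace ℝ (Fin 4))
      (F : SchwartzMap (Fin n → EuclideanSpace ℝ (Fin 4)) ℂ), IsOffDiagonal F →
      S n (translateMulti a F) = S n F)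
    (hRP : ∀ (R : EuclideanSpace ℝ (Fin 4) ≃ₗᵢ[ℝ] EuclideanSpace ℝ (Fin 4)) (a b : ℝ),
      a ^ 2 + b ^ 2 = 1 → (a = 0 ∨ b = 0 ∨ a ^ 2 = b ^ 2) →
      R (EuclideanSpace.single 0 1) = a • EuclideanSpace.single 0 1 + b • EuclideanSpace.single 1 1 →
      (SchwingerFamily.toLabelled (fun n => (S n).comp (linActMulti R))).IsReflectionPositive)
    (h : OSReconstructionNoE1 S.toLabelled)
    {m : ℕ} (G : SchwartzMap (Fin m → EuclideanSpace ℝ (Fin 4)) ℂ) (hG : IsTimeOrdered G)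
    (hGcone : tsupport (G : (Fin m → EuclideanSpace ℝ (Fin 4)) → ℂ) ⊆
      {x | (∀ i, |x i 1| < x i 0) ∧ ∀ i j, i < j → |x j 1 - x i 1| < x j 0 - x i 0}) :
    ∃ (M : ℝ) (Φ : (Fin 2 → ℂ) → ℂ),
      DifferentiableOn ℂ Φ (Literature.Analysis.Complex.sectorRegion 1 (Real.pi / 2)) ∧
      (∀ w ∈ Literature.Analysis.Complex.sectorRegion 1 (Real.pi / 2), ‖Φ w‖ ≤ M) ∧
      ∀ u : Fin 2 → ℝ, (∀ j, 0 < u j) →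
        Φ (fun j => (u j : ℂ)) = S (m + m) ((osAdjoint G).appendTensor
          (translateMulti (((u 0 + u 1) / Real.sqrt 2) • EuclideanSpace.single 0 1 +
            ((u 0 - u 1) / Real.sqrt 2) • EuclideanSpace.single 1 1) G)) := by
  obtain ⟨M, Esl, hdata⟩ := coneSectorData S hT hRP h G hG hGcone
  obtain ⟨Φ, hΦd, hΦr⟩ := hdata.exists_extension (by positivity) le_rfl
  refine ⟨M, Φ, hΦd, fun w hw => ?_, hΦr⟩
  obtain ⟨c, hc1, hc2⟩ := exists_between hw.2
  have hc0 : 0 < c := lt_of_le_of_lt (Finset.sum_nonneg fun j _ => abs_nonneg _) hc1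
  exact hdata.norm_extension_le le_rfl hΦd hΦr hc0 hc2
    (fun u hu => by simpa using hdata.bound u hu)
    (fun i u' τ hu' hτ hτc => by simpa using hdata.slot_bound i c hc2 u' τ hu' hτ hτc)
    ⟨hw.1, hc1⟩

/-- `EuclideanSpace.single 1 b = b • EuclideanSpace.single 1 1` in `ℝ⁴`. -/
theorem single_one_eq_smul (b : ℝ) :
    (EuclideanSpace.single 1 b : EuclideanSpace ℝ (Fin 4)) = b • EuclideanSpace.single 1 1 := by
  ext i
  by_cases hi : i = 1
  · subst hi; simp
  · simp [hi]

end FrontEnd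

/-! ## The stub -/

/-- **Stub 1 — FRONT END: disc sections for cone-chain diagonal pairs.** For `S` translation
invariant on `⁰𝒮` with the eight-frame pull-back reflection positivity, `h` its `e₀`-frame OS
reconstruction and `G` a strict cone chain, the diagonal matrix element
`b ↦ ⟪Ψ_G, e^{-tH} U(b e₁) Ψ_G⟫` has disc sections with delay `c = 0` and a `t`-uniform bound `M`:
for every `t > 0` it is the restriction to `(-t, t)` of a function holomorphic on the disc of radius
`t` bounded by `M`. Proof: `FrontEnd.exists_sectorExtension` (sector data of the cone chain from
the two diagonal frames + the tree's sector engine and maximum principle) and Thales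
(`stub_discSections_of_sectorExtension`). The hypotheses E0' and E3 are idle. -/
theorem stub_discSections (S : SchwingerFamily E4)
    (hlg : S.toLabelled.HasLinearGrowth) (hsym : S.toLabelled.IsSymmetric)
    (htr : ∀ (n : ℕ) (a : E4) (F : 𝓢((Fin n → E4), ℂ)), IsOffDiagonal F →
      S n (translateMulti a F) = S n F)
    (hRP : ∀ (R : E4 ≃ₗᵢ[ℝ] E4) (a b : ℝ), a ^ 2 + b ^ 2 = 1 → (a = 0 ∨ b = 0 ∨ a ^ 2 = b ^ 2) →
      R (EuclideanSpace.single 0 1) = a • EuclideanSpace.single 0 1 + b • EuclideanSpace.single 1 1 →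
        (SchwingerFamily.toLabelled (fun n => (S n).comp (linActMulti R))).IsReflectionPositive)
    (h : OSReconstructionNoE1 S.toLabelled) {m : ℕ} (G : 𝓢((Fin m → E4), ℂ)) (hG : IsTimeOrdered G)
    (hC : tsupport (G : (Fin m → E4) → ℂ) ⊆
      {x | (∀ i, |x i 1| < x i 0) ∧ ∀ i j, i < j → |x j 1 - x i 1| < x j 0 - x i 0}) :
    ∃ c M : ℝ, 0 ≤ c ∧ ∀ t : ℝ, c < t → ∃ f : ℂ → ℂ,
      DifferentiableOn ℂ f (Metric.ball 0 (t - c)) ∧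
        (∀ z ∈ Metric.ball (0 : ℂ) (t - c), ‖f z‖ ≤ M) ∧
          ∀ b : ℝ, |b| < t - c →
            f b = ⟪h.fieldVec m (fun _ => ()) G hG, h.transfer t
              (h.translate (EuclideanSpace.single 1 b) (h.fieldVec m (fun _ => ()) G hG))⟫_ℂ := by
  -- E0' (`hlg`) and E3 (`hsym`) are idle in the front end (cdisprove `sharpened_implies_crux`).
  have _ := hlg
  have _ := hsym
  obtain ⟨M, Φ, hΦd, hΦb, hΦr⟩ := FrontEnd.exists_sectorExtension S htr hRP h G hG hC
  have hdisc := stub_discSections_of_sectorExtension S h G hG M Φ hΦd hΦb hΦr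
  refine ⟨0, M, le_rfl, fun t ht => ?_⟩
  obtain ⟨f, hf, hfM, hfb⟩ := hdisc t ht
  rw [sub_zero]
  refine ⟨f, hf, hfM, fun b hb => ?_⟩
  rw [hfb b hb, FrontEnd.single_one_eq_smul b]

end Summit.QuantumFields.YangMills.Cruxes.PlanarSpectralCone.PositivityDiscToOperatorCone
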